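import Summits.QuantumFields.BalabanUV.T4Continuum.Support.DirichletRegionTower
import Summits.QuantumFields.BalabanUV.T4Continuum.Support.PerturbationAlgebra

/-!
# T⁴ programme, spine node NE2 (U1a), sub-row Δ1 «NE2⁰-Dirichlet» (T4-DAG `T4-U1a.S-NE2-D1-DIRICHLET°`) — THE Ω-RESTRICTED
# (DIRICHLET) FREE TOWER AT `U = 1`: the lineage's free tower (`Δ_a^{(k)}`, King's `Q_L`, the pairing `J_k`) COMPRESSED to the
# region generated by ONE unit-lattice predicate, with every `FreeTowerLaws` field PROVED except the injected two-level law,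
# which is DISPLAYED as the one missing inequality (typed wall)

Eleventh generation of the NE2 prover lineage P1 of the cell `pub-balaban` (row NE2 owner), file 4b (file 3
`Support/SubtypeCompression` = generic compression algebra; file 4a `Support/DirichletRegionTower` = §§1–3 below: the region tower,
compatibility, norms / exact pairing / coercivity; THIS file = the complement law and the END §4).  [Balaban1985BackgroundPropagators] §3 works with propagators restricted to regions: «the operator
Δ_a↾Ω₀ = Ω₀Δ_aΩ₀ … Its inverse is denoted by G» (p. 394, (3.27)), on a sequence of block-unions `{Ω_j}`.  Tier A/B of this lineage
are the SINGLE-REGION case `Ω₀ = T` (T4-DAG writer's ruling Q-NE2-c1, journal l.12453); the multi-region layer Δ1 needs, FIRST OF ALL,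
the `U = 1` FREE-TOWER LAWS (`BackgroundResolventTower.FreeTowerLaws`) for the Ω-restricted operators — printed only η-UNIFORMLY
([B9] Thm 3.2 (3.42) p. 397), never as a two-spacing RATE.  This file TYPES that tower and proves what transfers from the torus:

 * §1 THE REGION TOWER: from a decidable predicate `S₀` on the unit lattice `idx L M 0` (sites × components), the level-`k` region
   `inReg S₀ k` = «the unit block of the site lies in `S₀`» (iterated block parents `par`), its index types `ridx S₀ k`, and the
   COMPRESSED objects `DalevR k = (Δ_a^{(k)})_{ΩΩ}` (Bałaban's `Ω₀Δ_aΩ₀` as an operator on `ℓ²(Ω)`), `QlevR k`, `JpcTR k`.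
 * §2 COMPATIBILITY: King's block averaging `Q_L` and the piecewise-constant pairing `J_k = L^{d/2}Q_Lᴴ` never couple a site inside the
   region to one outside (a fine site and its block parent are in or out together) — so compression is multiplicative on every
   product the tower uses (`SubtypeCompression.toBlock_mul_of_vanish_*`).
 * §3 THE TRANSFERRED FIELDS: `‖QlevR k‖² ≤ L^{−d}`, `‖JpcTR k‖ ≤ 1`, the EXACT pairing `√(L^d)·QlevR k·JpcTR k = 1`, COERCIVITY
   `((d+1)Cst)⁻¹·‖v‖² ≤ Re⟨v, Δ_a v⟩` of Bałaban's `Δ_a` (from the tree's (1.89)⟹(1.90) inequality `B5Prop11Lower.form_LapOne_le`) hence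
   of every compression: `DalevR k` invertible, `‖(DalevR k)⁻¹‖ ≤ (d+1)Cst` («G(Ω) exists and is bounded uniformly»), and the
   COMPLEMENT LAW **`complement_le_R`**: `‖(DalevR (k+1))⁻¹(1 − J_kJ_kᴴ)_{ΩΩ}‖ ≤ 2d(d+1)Cst·L^{−k}` — the block Poincaré inequality
   `BalabanBlockPoincare.opNorm_one_sub_Pi_mul_le` applied to the zero-extended Dirichlet Green function, whose lattice gradients are
   bounded through the coercive form (no Fourier analysis: this is the part of the torus proof that survives the loss of
   translation invariance).
 * §4 THE END **`freeTowerLaws_dirichlet_of_injected`**: `FreeTowerLaws (DalevR S₀) (QlevR S₀) (JpcTR S₀) 0 L^d (2d(d+1)Cst·L^{−k}) e₁ 0`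
   from ONE displayed binder `hinj : ∀ k, ‖(DalevR (k+1))⁻¹·JpcTR k − JpcTR k·(DalevR k)⁻¹‖ ≤ e₁ k` — THE INJECTED TWO-LEVEL LAW OF THE
   DIRICHLET TOWER, the one missing inequality of Δ1 at `U = 1`; and the consequences at any geometric rate `θ ∈ [L⁻¹, 1)`:
   **`towerLimitRate_dirichlet_of_injected`** (the Ω-restricted unit-lattice free covariances converge with rate `θ`) and
   **`towerLimitRate_dirichlet_perturbed`** (the whole resolvent route of tiers A/B runs VERBATIM over the restricted carriers, for any
   compressed perturbation family obeying `PerturbationLaws`).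

WHY `hinj` IS A WALL, AND WHAT KIND (located gap, owner's census `t4/T4-EST-NE2-P1.md` §G11).  On the torus the injected law
`‖𝒢^{(k+1)}J_k − J_k𝒢^{(k)}‖ ≤ CJ·L^{−k}` is `KingPairingPlantedLaw.injected_le_lev`, proved by PLANCHEREL (`B5G183RateTorusW`: fibrewise
symbols over momentum cosets).  A region has no translation invariance; the real-space content of the law is a two-level comparison
of DIRICHLET problems with rough (`ℓ²`) data, i.e. discrete elliptic regularity UP TO THE BOUNDARY of a union of cubes, uniformly in
the spacing — for non-convex unions (re-entrant edges) `H²`-regularity fails and the expected rate is `θ = L^{−γ}`, `γ < 1`, which is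
why §4 is stated at a general rate (row B8).  Not in print at two spacings ([B9] prints the η-uniform bounds (3.42) only).  Nothing
here asserts `hinj`.

HONEST FRAMING (T4-DAG p. 1).  `U = 1`; ONE region (a decidable predicate — no carrier of Bałaban's `{Ω_j}`, no recursive `a_j`, no
Dirichlet data on the gauge-term's inner propagators); finite torus; linear layer; operator norm; statements, pairing and constants
OURS ([folklore] over landed modules; `[cite:]` tags locate SHAPES); NOT [B9] (3.23)–(3.27) as printed; NE2 (U1a) NOT proved; spine
0/9 unchanged; NOT infinite volume, NOT a mass gap, NOT the Clay problem, NOT summit progress.  HONEST DEPENDENCY: continuum YM on T⁴ ⇐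
BetaPertH ∧ nine spine estimates (0/9 proved); BetaPertH ⇐ (D1) ∧ (D4) ∧ CAP+tail; G-an2-4 gates asym, D1 and NE2/3/4.  No `sorry`.
-/

noncomputable section

open scoped BigOperators ComplexConjugate Matrix Matrix.Norms.L2Operator
open Filter Topology

namespace Summit.QuantumFields.BalabanUV.T4Continuum.DirichletFreeTower

open Literature.MathematicalPhysics.QuantumFieldTheory.Balaban1983to89.B5Prop11Plancherel (Cst Cst_nonneg Tor fine fdiff shiftM
  opNorm_le_of_sq_le)
open Literature.MathematicalPhysics.QuantumFieldTheory.Balaban1983to89.B5Prop11Inverse (calDa calDa_isHermitian)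
open Literature.MathematicalPhysics.QuantumFieldTheory.Balaban1983to89.B5Prop11Lower (nsq nsq_nonneg star_dotProduct_self
  norm_star_dotProduct_le nsq_mulVec_le Vb form_LapOne_le one_le_Cst)
open Literature.MathematicalPhysics.QuantumFieldTheory.Balaban1983to89.B5G183RateTorusW (Qavg off)
open Literature.MathematicalPhysics.QuantumFieldTheory.Balaban1983to89.B5G183RateUnitTower (lev lev_neZero)
open Summit.QuantumFields.BalabanUV.T4Continuum
open Summit.QuantumFields.BalabanUV.T4Continuum.CovariantAveragingTower (TowerLimitRate)
open Summit.QuantumFields.BalabanUV.T4Continuum.BalabanAveragedTowerUnit (idx Qlev one_le_lev' cast_lev' opNorm_Qlev_sq_le)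
open Summit.QuantumFields.BalabanUV.T4Continuum.BalabanAveragedTowerModes (par eq_par_rem_of_eq)
open Summit.QuantumFields.BalabanUV.T4Continuum.BalabanBlockPoincare (Pi opNorm_one_sub_Pi_mul_le opNorm_shiftM_sub_one_mul_le)
open Summit.QuantumFields.BalabanUV.T4Continuum.BackgroundResolventTower
open Summit.QuantumFields.BalabanUV.T4Continuum.KingPairingPlantedLaw (JK JpcT JpcT_eq_JK JK_mul_conjTranspose Pi_conjTranspose
  opNorm_JpcT_le calDalev sqrt_smul_Qlev_mul_JpcT)
open Summit.QuantumFields.BalabanUV.T4Continuum.SubtypeCompression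
open Summit.QuantumFields.BalabanUV.T4Continuum.DirichletRegionTower
open Summit.QuantumFields.BalabanUV.T4Continuum.PerturbationAlgebra (perturbationLaws_zero)

variable {d : ℕ} (L : ℕ) [NeZero L] (M : Fin d → ℕ) [hM : ∀ μ, NeZero (M μ)]
variable (a : ℝ) (ha : 0 < a) (S₀ : idx L M 0 → Prop) [DecidablePred S₀]

/-! ## §3 (continued) The complement law on the region (block Poincaré on the zero-extended Dirichlet Green function) -/

section Complement

variable (k : ℕ)

/-- `J_kJ_kᴴ` compressed is the compressed block-mean projector `Π_{ΩΩ}`. [folklore] -/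
theorem JpcTR_mul_conjTranspose :
    JpcTR L M S₀ k * (JpcTR L M S₀ k)ᴴ = (PiT L M k).toBlock (inReg L M S₀ (k + 1)) (inReg L M S₀ (k + 1)) := by
  rw [JpcTR, toBlock_conjTranspose, ← toBlock_mul_of_vanish_left _ _ _ _ _ (JpcT_vanish₁ L M S₀ k), JpcT_mul_conjTranspose]

/-- `1 − Π` does not couple the region to its complement (left form). [folklore] -/
theorem one_sub_Pi_vanish₁ : ∀ (y z : idx L M (k + 1)),
    inReg L M S₀ (k + 1) y → ¬ inReg L M S₀ (k + 1) z → (1 - PiT L M k) y z = 0 := by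
  intro y z hy hz
  have hne : y ≠ z := fun h => hz (h ▸ hy)
  rw [Matrix.sub_apply, Matrix.one_apply_ne hne, zero_sub, neg_eq_zero, ← JpcT_mul_conjTranspose, Matrix.mul_apply]
  refine Finset.sum_eq_zero fun i _ => ?_
  by_cases hi : inReg L M S₀ k i
  · rw [Matrix.conjTranspose_apply, JpcT_vanish₂ L M S₀ k z i hz hi, star_zero, mul_zero]
  · rw [JpcT_vanish₁ L M S₀ k y i hy hi, zero_mul]

/-- `1 − Π` does not couple the complement to the region (right form). [folklore] -/
theorem one_sub_Pi_vanish₂ : ∀ (y z : idx L M (k + 1)),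
    ¬ inReg L M S₀ (k + 1) y → inReg L M S₀ (k + 1) z → (1 - PiT L M k) y z = 0 := by
  intro y z hy hz
  have h := one_sub_Pi_vanish₁ L M S₀ k z y hz hy
  have hH : (1 - PiT L M k)ᴴ = 1 - PiT L M k := by
    rw [Matrix.conjTranspose_sub, Matrix.conjTranspose_one, PiT_conjTranspose]
  rw [← hH, Matrix.conjTranspose_apply, h, star_zero]

/-- the ZERO-EXTENDED DIRICHLET GREEN FUNCTION `X = selᴴ·G(Ω)·sel` as an operator on the whole fine torus. [folklore] -/
def extG : Matrix (idx L M (k + 1)) (idx L M (k + 1)) ℂ :=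
  (sel (inReg L M S₀ (k + 1)))ᴴ * (DalevR L M a ha S₀ (k + 1))⁻¹ * sel (inReg L M S₀ (k + 1))

/-- its action: restrict, apply `G(Ω)`, extend by zero. [folklore] -/
theorem extG_mulVec (y : idx L M (k + 1) → ℂ) :
    extG L M a ha S₀ k *ᵥ y
      = ext (inReg L M S₀ (k + 1)) ((DalevR L M a ha S₀ (k + 1))⁻¹ *ᵥ fun z : ridx L M S₀ (k + 1) => y z) := by
  have h1 : sel (inReg L M S₀ (k + 1)) *ᵥ y = fun z : ridx L M S₀ (k + 1) => y z := by
    funext z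
    simp only [Matrix.mulVec, dotProduct, sel, ite_mul, one_mul, zero_mul, Finset.sum_ite_eq, Finset.mem_univ, if_true]
  have h2 : ∀ w : ridx L M S₀ (k + 1) → ℂ, (sel (inReg L M S₀ (k + 1)))ᴴ *ᵥ w = ext (inReg L M S₀ (k + 1)) w := by
    intro w
    funext i
    simp only [Matrix.mulVec, dotProduct, Matrix.conjTranspose_apply, sel, apply_ite star, star_one, star_zero, ite_mul,
      one_mul, zero_mul, ext]
    by_cases hi : inReg L M S₀ (k + 1) i
    · rw [dif_pos hi, Finset.sum_eq_single ⟨i, hi⟩]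
      · simp
      · intro b _ hb
        rw [if_neg]
        intro h; exact hb (Subtype.ext h)
      · intro h; exact absurd (Finset.mem_univ _) h
    · rw [dif_neg hi]
      refine Finset.sum_eq_zero fun b _ => ?_
      rw [if_neg]
      intro h; exact hi (h ▸ b.2)
  rw [extG, ← Matrix.mulVec_mulVec, ← Matrix.mulVec_mulVec, h1, h2]

/-- **THE GRADIENT BOUND**: `‖∇_ν · extG‖ ≤ (d+1)Cst` — lattice gradients of the zero-extended Dirichlet Green function, through the
coercive form `Re⟨ext v, Δ_a ext v⟩ = Re⟨v, w⟩`. [folklore] -/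
theorem opNorm_fdiff_mul_extG_le (ν : Fin d) :
    ‖fdiff (fine (lev L (k + 1)) M) ((lev L (k + 1) : ℕ) : ℂ) ν * extG L M a ha S₀ k‖ ≤ ((d : ℝ) + 1) * Cst d a := by
  set p := inReg L M S₀ (k + 1) with hp
  set K : ℝ := ((d : ℝ) + 1) * Cst d a with hK
  have hK0 : 0 < K := K_pos a
  set D := DalevR L M a ha S₀ (k + 1) with hD
  have hU : IsUnit D.det := isUnit_det_DalevR L M a ha S₀ (k + 1)
  have hG : ‖D⁻¹‖ ≤ K := opNorm_inv_DalevR_le L M a ha S₀ (k + 1)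
  refine opNorm_le_of_sq_le _ hK0.le fun y => ?_
  -- the vector language
  set w : ridx L M S₀ (k + 1) → ℂ := fun z => y z with hw
  set v : ridx L M S₀ (k + 1) → ℂ := D⁻¹ *ᵥ w with hv
  have e1 : ∑ i, ‖∑ j, (fdiff (fine (lev L (k + 1)) M) ((lev L (k + 1) : ℕ) : ℂ) ν * extG L M a ha S₀ k) i j * y j‖ ^ 2
      = nsq (fdiff (fine (lev L (k + 1)) M) ((lev L (k + 1) : ℕ) : ℂ) ν *ᵥ ext p v) := by
    have e0 : ∑ i, ‖∑ j, (fdiff (fine (lev L (k + 1)) M) ((lev L (k + 1) : ℕ) : ℂ) ν * extG L M a ha S₀ k) i j * y j‖ ^ 2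
        = nsq ((fdiff (fine (lev L (k + 1)) M) ((lev L (k + 1) : ℕ) : ℂ) ν * extG L M a ha S₀ k) *ᵥ y) := rfl
    rw [e0, ← Matrix.mulVec_mulVec, extG_mulVec]
  have e2 : ∑ j, ‖y j‖ ^ 2 = nsq y := rfl
  rw [e1, e2]
  -- (i) gradient through the form
  have h1 := nsq_fdiff_le_form M a ha (lev L (k + 1)) (one_le_lev' L (k + 1)) ν (ext p v)
  -- (ii) the form of the extension is the compressed form, and `D v = w`
  have hDv : D *ᵥ v = w := by
    rw [hv, Matrix.mulVec_mulVec, Matrix.mul_nonsing_inv _ hU, Matrix.one_mulVec]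
  have h2 : star (ext p v) ⬝ᵥ (calDa (lev L (k + 1)) (one_le_lev' L (k + 1)) M a ha *ᵥ ext p v) = star v ⬝ᵥ w := by
    rw [← hDv, hD, DalevR, form_toBlock]; rfl
  rw [h2] at h1
  -- (iii) Cauchy–Schwarz and the inverse bound
  have h3 : (star v ⬝ᵥ w).re ≤ Real.sqrt (nsq v) * Real.sqrt (nsq w) :=
    (Complex.re_le_norm _).trans (norm_star_dotProduct_le v w)
  have h4 : nsq v ≤ K ^ 2 * nsq w :=
    (nsq_mulVec_le D⁻¹ w).trans (mul_le_mul_of_nonneg_right (pow_le_pow_left₀ (norm_nonneg _) hG 2) (nsq_nonneg _))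
  have h5 : Real.sqrt (nsq v) ≤ K * Real.sqrt (nsq w) := by
    rw [← Real.sqrt_sq hK0.le, ← Real.sqrt_mul (sq_nonneg _)]
    exact Real.sqrt_le_sqrt h4
  have h6 : nsq w ≤ nsq y := by
    rw [hw]; unfold nsq
    rw [← Fintype.sum_subtype_add_sum_subtype p (fun i => ‖y i‖ ^ 2)]
    exact le_add_of_nonneg_right (Finset.sum_nonneg fun _ _ => by positivity)
  have hsw : Real.sqrt (nsq w) * Real.sqrt (nsq w) = nsq w := Real.mul_self_sqrt (nsq_nonneg _)
  calc nsq (fdiff (fine (lev L (k + 1)) M) ((lev L (k + 1) : ℕ) : ℂ) ν *ᵥ ext p v)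
      ≤ K * (star v ⬝ᵥ w).re := h1
    _ ≤ K * (Real.sqrt (nsq v) * Real.sqrt (nsq w)) := mul_le_mul_of_nonneg_left h3 hK0.le
    _ ≤ K * (K * Real.sqrt (nsq w) * Real.sqrt (nsq w)) :=
        mul_le_mul_of_nonneg_left (mul_le_mul_of_nonneg_right h5 (Real.sqrt_nonneg _)) hK0.le
    _ = K ^ 2 * nsq w := by rw [mul_assoc K, hsw]; ring
    _ ≤ K ^ 2 * nsq y := mul_le_mul_of_nonneg_left h6 (sq_nonneg _)

/-- hence the block Poincaré inequality: `‖(1 − Π)·extG‖ ≤ 2d(d+1)Cst·L^{−k}`. [folklore] -/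
theorem opNorm_one_sub_Pi_mul_extG_le :
    ‖(1 - PiT L M k) * extG L M a ha S₀ k‖ ≤ 2 * d * (((d : ℝ) + 1) * Cst d a) * ((L : ℝ)⁻¹) ^ k := by
  have hc : (((lev L (k + 1) : ℕ) : ℂ)) ≠ 0 := by exact_mod_cast (NeZero.ne (lev L (k + 1)))
  have hδ : ∀ ν, ‖(shiftM (fine (lev L (k + 1)) M) ν - 1) * extG L M a ha S₀ k‖
      ≤ (((d : ℝ) + 1) * Cst d a) / ‖(((lev L (k + 1) : ℕ) : ℂ))‖ :=
    fun ν => opNorm_shiftM_sub_one_mul_le _ hc ν (opNorm_fdiff_mul_extG_le L M a ha S₀ k ν)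
  have hn : ‖(((lev L (k + 1) : ℕ) : ℂ))‖ = (L : ℝ) ^ (k + 1) := by
    rw [Complex.norm_natCast, cast_lev']
  rw [hn] at hδ
  have hδ0 : 0 ≤ (((d : ℝ) + 1) * Cst d a) / (L : ℝ) ^ (k + 1) := div_nonneg (K_pos a).le (pow_nonneg (Nat.cast_nonneg L) _)
  have h : ‖(1 - PiT L M k) * extG L M a ha S₀ k‖ ≤ 2 * (d * L * ((((d : ℝ) + 1) * Cst d a) / (L : ℝ) ^ (k + 1))) :=
    opNorm_one_sub_Pi_mul_le (lev L k) L M (extG L M a ha S₀ k) hδ0 (fun ν => by exact hδ ν)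
  refine h.trans (le_of_eq ?_)
  have hL : (L : ℝ) ≠ 0 := by exact_mod_cast NeZero.ne L
  rw [inv_pow, pow_succ]
  field_simp

/-- **THE COMPLEMENT LAW ON THE REGION**: `‖G^{(k+1)}(Ω)·(1 − J_kJ_kᴴ)_{ΩΩ}‖ ≤ 2d(d+1)Cst·L^{−k}` — the Dirichlet Green function is small off
the block-constant fields, at the rate of the block size, uniformly in the region. [cite: Balaban1985BackgroundPropagators, p.394
(3.27) (shape); King1986, (2.10) p.653] [folklore] -/
theorem complement_le_R :
    ‖(DalevR L M a ha S₀ (k + 1))⁻¹ * (1 - JpcTR L M S₀ k * (JpcTR L M S₀ k)ᴴ)‖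
      ≤ 2 * d * (((d : ℝ) + 1) * Cst d a) * ((L : ℝ)⁻¹) ^ k := by
  set p := inReg L M S₀ (k + 1) with hp
  set G := (DalevR L M a ha S₀ (k + 1))⁻¹ with hG
  set Y := (1 - PiT L M k).toBlock p p with hY
  have hJJ : 1 - JpcTR L M S₀ k * (JpcTR L M S₀ k)ᴴ = Y := by
    rw [JpcTR_mul_conjTranspose, hY, toBlock_sub, toBlock_one]
  rw [hJJ]
  -- both factors are Hermitian, so `‖G·Y‖ = ‖Y·G‖`
  have hGh : Gᴴ = G := (DalevR_isHermitian L M a ha S₀ (k + 1)).inv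
  have hPi : (1 - PiT L M k)ᴴ = 1 - PiT L M k := by
    rw [Matrix.conjTranspose_sub, Matrix.conjTranspose_one, PiT_conjTranspose]
  have hYh : Yᴴ = Y := by rw [hY, toBlock_conjTranspose, hPi]
  have e1 : ‖G * Y‖ = ‖Y * G‖ := by
    rw [← Matrix.l2_opNorm_conjTranspose (G * Y), Matrix.conjTranspose_mul, hGh, hYh]
  rw [e1]
  -- `Y·G = sel·((1 − Π)·extG)·selᴴ`
  have e2 : Y * G = sel p * ((1 - PiT L M k) * extG L M a ha S₀ k) * (sel p)ᴴ := by
    have hvan : (1 - PiT L M k) * (sel p)ᴴ = (sel p)ᴴ * Y := by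
      ext i b
      rw [mul_sel_conjTranspose_apply, Matrix.mul_apply]
      by_cases hi : p i
      · rw [Finset.sum_eq_single ⟨i, hi⟩]
        · simp [sel, hY, Matrix.toBlock_apply]
        · intro c _ hc
          have : (sel p)ᴴ i c = 0 := by
            rw [Matrix.conjTranspose_apply]; simp only [sel]
            rw [if_neg, star_zero]; intro h; exact hc (Subtype.ext h)
          rw [this, zero_mul]
        · intro h; exact absurd (Finset.mem_univ _) h
      · have h0 : (1 - PiT L M k) i b = 0 := one_sub_Pi_vanish₂ L M S₀ k i b hi b.2
        rw [h0]
        symm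
        refine Finset.sum_eq_zero fun c _ => ?_
        have : (sel p)ᴴ i c = 0 := by
          rw [Matrix.conjTranspose_apply]; simp only [sel]
          rw [if_neg, star_zero]; intro h; exact hi (h ▸ c.2)
        rw [this, zero_mul]
    show Y * G = sel p * ((1 - PiT L M k) * ((sel p)ᴴ * G * sel p)) * (sel p)ᴴ
    calc Y * G = Y * G * (sel p * (sel p)ᴴ) := by rw [sel_mul_sel_conjTranspose, Matrix.mul_one]
      _ = ((sel p * (sel p)ᴴ) * Y) * G * (sel p * (sel p)ᴴ) := by rw [sel_mul_sel_conjTranspose, Matrix.one_mul]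
      _ = sel p * (((sel p)ᴴ * Y) * G * sel p) * (sel p)ᴴ := by simp only [Matrix.mul_assoc]
      _ = sel p * (((1 - PiT L M k) * (sel p)ᴴ) * G * sel p) * (sel p)ᴴ := by rw [hvan]
      _ = sel p * ((1 - PiT L M k) * ((sel p)ᴴ * G * sel p)) * (sel p)ᴴ := by simp only [Matrix.mul_assoc]
  rw [e2]
  calc ‖sel p * ((1 - PiT L M k) * extG L M a ha S₀ k) * (sel p)ᴴ‖
      ≤ ‖sel p * ((1 - PiT L M k) * extG L M a ha S₀ k)‖ * ‖(sel p)ᴴ‖ := Matrix.l2_opNorm_mul _ _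
    _ ≤ ‖sel p‖ * ‖(1 - PiT L M k) * extG L M a ha S₀ k‖ * ‖(sel p)ᴴ‖ :=
        mul_le_mul_of_nonneg_right (Matrix.l2_opNorm_mul _ _) (norm_nonneg _)
    _ ≤ 1 * (2 * d * (((d : ℝ) + 1) * Cst d a) * ((L : ℝ)⁻¹) ^ k) * 1 := by
        rw [Matrix.l2_opNorm_conjTranspose]
        have hs := opNorm_sel_le p
        have hb := opNorm_one_sub_Pi_mul_extG_le L M a ha S₀ k
        have h0 : 0 ≤ 2 * d * (((d : ℝ) + 1) * Cst d a) * ((L : ℝ)⁻¹) ^ k := (norm_nonneg _).trans hb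
        exact mul_le_mul (mul_le_mul hs hb (norm_nonneg _) zero_le_one) hs (norm_nonneg _) (by rw [one_mul]; exact h0)
    _ = _ := by ring

end Complement

/-! ## §4 The END: the Dirichlet free tower modulo the injected law, and its consequences at a general rate -/

/-- **THE Ω-RESTRICTED FREE TOWER LAWS MODULO THE INJECTED LAW** (`U = 1`): every field of `FreeTowerLaws` for the compressed tower is
a THEOREM (invertibility, `‖QlevR‖² ≤ L^{−d}`, `‖JpcTR‖ ≤ 1`, exact pairing with `F = 0`, complement law `2d(d+1)Cst·L^{−k}`) except the
injected two-level law, displayed as `hinj` — THE typed wall of sub-row Δ1 (not in print at two spacings; see the module docstring).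
[cite: Balaban1985BackgroundPropagators, p.394 (3.27), Thm 3.2 (3.42) p.397 (η-uniform kind only)] [folklore] -/
theorem freeTowerLaws_dirichlet_of_injected {e₁ : ℕ → ℝ}
    (hinj : ∀ k, ‖(DalevR L M a ha S₀ (k + 1))⁻¹ * JpcTR L M S₀ k - JpcTR L M S₀ k * (DalevR L M a ha S₀ k)⁻¹‖ ≤ e₁ k) :
    FreeTowerLaws (DalevR L M a ha S₀) (QlevR L M S₀) (JpcTR L M S₀) (fun _ => 0) ((L : ℝ) ^ d)
      (fun k => 2 * d * (((d : ℝ) + 1) * Cst d a) * ((L : ℝ)⁻¹) ^ k) e₁ (fun _ => 0) where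
  isUnit_det := isUnit_det_DalevR L M a ha S₀
  opNorm_A_sq_le := opNorm_QlevR_sq_le L M S₀
  opNorm_J_le := opNorm_JpcTR_le L M S₀
  A_mul_J := sqrt_smul_QlevR_mul_JpcTR L M S₀
  opNorm_F_mul_inv_le := fun k => by rw [Matrix.zero_mul, norm_zero]
  opNorm_inv_mul_F_le := fun k => by rw [Matrix.conjTranspose_zero, Matrix.mul_zero, norm_zero]
  complement_le := complement_le_R L M a ha S₀
  injected_le := hinj

/-- **THE Ω-RESTRICTED UNIT-LATTICE FREE COVARIANCES CONVERGE, MODULO THE INJECTED LAW, AT ANY GEOMETRIC RATE `θ ∈ [L⁻¹, 1)`**: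
`hinj` with majorant `C₁θ^k` ⟹ `TowerLimitRate (QlevR S₀) L^d (k ↦ G^{(k)}(Ω)) (Cpert 0 (2d(d+1)Cst) C₁ 0 0 0) θ` — the Dirichlet analogue of
tier A's free limit, displayed at a general rate because the expected Dirichlet rate is slower than `L⁻¹` (row B8).
[cite: King1986, Lemma 4.5 (4.38) p.674 (shape)] [folklore] -/
theorem towerLimitRate_dirichlet_of_injected {θ C₁ : ℝ} (hθ : ((L : ℝ)⁻¹) ≤ θ) (hθ1 : θ < 1)
    (hinj : ∀ k, ‖(DalevR L M a ha S₀ (k + 1))⁻¹ * JpcTR L M S₀ k - JpcTR L M S₀ k * (DalevR L M a ha S₀ k)⁻¹‖ ≤ C₁ * θ ^ k) :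
    TowerLimitRate (QlevR L M S₀) ((L : ℝ) ^ d) (fun k => (DalevR L M a ha S₀ k)⁻¹)
      (Cpert 0 (2 * d * (((d : ℝ) + 1) * Cst d a)) C₁ 0 0 0) θ := by
  have hr : (0 : ℝ) < (L : ℝ) ^ d := pow_pos (by exact_mod_cast Nat.pos_of_ne_zero (NeZero.ne L)) d
  have hC₀ : 0 ≤ 2 * d * (((d : ℝ) + 1) * Cst d a) := by have := (K_pos (d := d) a).le; positivity
  have ht : ‖(0 : ℂ)‖ * 0 < 1 := by rw [norm_zero, zero_mul]; exact one_pos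
  have h := towerLimitRate_perturbed hr (freeTowerLaws_dirichlet_of_injected L M a ha S₀ hinj)
    (perturbationLaws_zero (D := DalevR L M a ha S₀) (J := JpcTR L M S₀)) hθ1
    (fun k => mul_le_mul_of_nonneg_left (pow_le_pow_left₀ (inv_nonneg.mpr (Nat.cast_nonneg L)) hθ k) hC₀)
    (fun k => le_rfl) (fun k => by rw [zero_mul]) (fun k => by rw [zero_mul]) ht
  simp only [zero_smul, add_zero] at h
  exact h

/-- **THE RESOLVENT ROUTE RUNS VERBATIM OVER THE REGION**: for every compressed perturbation family `P` with
`PerturbationLaws (DalevR S₀) P (JpcTR S₀) κ (k ↦ C₂θ^k)` and every `‖t‖κ < 1`, the Ω-restricted perturbed covariances converge at rate `θ`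
(modulo `hinj`).  This is how tiers A/B would be re-run on `{Ω_j}` once the injected law is supplied. [folklore] -/
theorem towerLimitRate_dirichlet_perturbed {θ C₁ : ℝ} (hθ : ((L : ℝ)⁻¹) ≤ θ) (hθ1 : θ < 1)
    (hinj : ∀ k, ‖(DalevR L M a ha S₀ (k + 1))⁻¹ * JpcTR L M S₀ k - JpcTR L M S₀ k * (DalevR L M a ha S₀ k)⁻¹‖ ≤ C₁ * θ ^ k)
    {P : (k : ℕ) → Matrix (ridx L M S₀ k) (ridx L M S₀ k) ℂ} {κ C₂ : ℝ}
    (hpert : PerturbationLaws (DalevR L M a ha S₀) P (JpcTR L M S₀) κ (fun k => C₂ * θ ^ k)) {t : ℂ} (ht : ‖t‖ * κ < 1) :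
    TowerLimitRate (QlevR L M S₀) ((L : ℝ) ^ d) (fun k => (DalevR L M a ha S₀ k + t • P k)⁻¹)
      (Cpert κ (2 * d * (((d : ℝ) + 1) * Cst d a)) C₁ C₂ 0 t) θ := by
  have hr : (0 : ℝ) < (L : ℝ) ^ d := pow_pos (by exact_mod_cast Nat.pos_of_ne_zero (NeZero.ne L)) d
  have hC₀ : 0 ≤ 2 * d * (((d : ℝ) + 1) * Cst d a) := by have := (K_pos (d := d) a).le; positivity
  exact towerLimitRate_perturbed hr (freeTowerLaws_dirichlet_of_injected L M a ha S₀ hinj) hpert hθ1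
    (fun k => mul_le_mul_of_nonneg_left (pow_le_pow_left₀ (inv_nonneg.mpr (Nat.cast_nonneg L)) hθ k) hC₀)
    (fun k => le_rfl) (fun k => le_rfl) (fun k => by rw [zero_mul]) ht

end Summit.QuantumFields.BalabanUV.T4Continuum.DirichletFreeTower

end
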